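import Literature.NumberTheory.Automorphic.CMPrincipalSeriesTraceTorusForm            -- ★ S1 van Dijk in TORUS form (`exists_smoothTrace_cmPrincipalSeries_eq_integral_torus`)
import Literature.NumberTheory.Automorphic.UnitaryGroupTorusOrbitalIntegralCanonical  -- ★ S0 canonical orbital integral at a regular diagonal class
import Literature.NumberTheory.Automorphic.CMPrincipalSeriesJacquetEvalOne            -- ★ `nonarchimedeanGroup_unitaryGroupOfForm_local`, `continuous_proj_borelTriple`
import Literature.NumberTheory.Automorphic.CMBorelIwahoriShellBound                   -- ★ `isClosed_cmBorelTriple_M`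
import Literature.NumberTheory.Automorphic.CMBorelUnipotentIndexModulus               -- ★ `isClosed_cmBorelTriple_N`
import Literature.NumberTheory.Automorphic.UnitaryGroupCMLocalIwasawa                 -- ★ `exists_borel_mul_mem_cmLocalIntegralLevel`
import Literature.NumberTheory.Automorphic.LocalUnitaryIntegralLevel                  -- ★ `isCompact_isOpen_cmLocalIntegralLevel`
import Literature.NumberTheory.Automorphic.UnitaryGroupFormCongrFinSum                -- ★ `formCongr_one_eq` (identity frame)
import Literature.NumberTheory.Automorphic.VanDijkTraceParabolicIndGLProof            -- ★ `continuous_rootDeltaChar_unitsCoe'`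
import Literature.MeasureTheory.Group.CharacterIntegralsContinuousUniq                -- ★ 47e E1 p853352 (LH6-p04): Fourier uniqueness for continuous `C_c(T)`
import Literature.NumberTheory.Automorphic.ConstantTermTorusContinuous               -- ★ 47e E2 p853356 (F0P2-p06): the constant term is continuous with compact support on `T`
import Literature.NumberTheory.Rogawski1990.Ch12Sec5Defs                              -- ★ organ `EllipticData` (`orbInt`)
import Summits.HodgeConjecture.HodgeConjecture.Theorems.F0P3cStCharTSEllCartanCompact   -- ★ `isCompact_centralizer_iff_not_mem_hyperbolicSet` (+ `hyperbolicSet`, `Gqs`)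
import Summits.HodgeConjecture.HodgeConjecture.Theorems.F0P3cStCharTSWeylHypFibre       -- ★ `isUnit_sub_of_isRegularElt_glDiagonal`
import HarnessLib

/-!
# F0 · P3c · «StCharTS» — E1 ROW 47e (R-e DATUM): NON-ELLIPTIC VANISHING OF CANONICAL ORBITAL INTEGRALS FROM VANISHING OF ALL PRINCIPAL-SERIES TRACES
# `(∀ χ, tr i_G(χ)(φ) = 0) ⇒ Φ^{can}(γ, φ) = 0` for every regular `γ ∈ U(Φ₃)(L⁺_v)` with NON-COMPACT centraliser  [Rogawski1990 §12.6–12.7; SS97 III.4; Korman2004 §9]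

Cell `pub/hodgecm-mathlib`, crux H413 = `stmt-HodgeConjecture-24833` (`--supports … --as helper`), route HCCMUnconditional; E1 row 47 census
`F0/P3/F0P3-p02/g26/nonell/CENSUS-NONELL-VANISHING.v1.F0P3p02g26.md` §2 route A (A4)–(A6), §5 R47-e; my census `F0/P3b/LH6-p04/g11/r47e/CENSUS-R47E.v1.LH6p04g11.md`
(door 2); seat LH6-p04 (g11).  THEOREMS ONLY (no definition, no instance, no notation, no named fact, no `sorry`).

THE MATHEMATICS.  `G = U(Φ₃)(L⁺_v)` at a finite place `v` of `L⁺` inert or ramified in the CM field `L` (`hns`), `T` the diagonal torus, `B = T N` the Borel, `K = K_v`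
hyperspecial.  For a locally constant compactly supported `φ` on `G`:
(A4) ★ S1 (van Dijk, torus form) `tr i_G(χ)(φ) = C · ∫_T χ(t) δ_B^{1∕2}(t) Ψ_φ(t) dμ_T`, `Ψ_φ(t) = ∫_{K×N} φ(k (t n) k⁻¹)`, `C > 0`, for EVERY continuous `χ : T →* ℂˣ`;
(A5) `Ψ_φ` is continuous with compact support on `T` (★ E2 `continuous_integral_conj_torus_mul_prod` ∕ `hasCompactSupport_integral_conj_torus_mul_prod`, F0P2-p06), `T` has
  small compact open subgroups (§1), so ★ E1 `eq_zero_of_continuous_of_forall_integral_char_mul_eq_zero` turns «all traces vanish» into «`δ^{1∕2} Ψ_φ ≡ 0` on `T`», i.e.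
  `Ψ_φ ≡ 0`;
(A6) ★ S0 `classOrbitalIntegral_eq_smul_integral_prod_of_torus_regular`: at a REGULAR `t ∈ T`, `Φ^{can}(t, φ) = c(t) • Ψ_φ(t)`, so `Φ^{can}(t, φ) = 0`; every regular `γ` with
  non-compact centraliser is conjugate to such a `t` (★ `isCompact_centralizer_iff_not_mem_hyperbolicSet`), and `Φ^{can}` is a class function.
HEAD `classOrbitalIntegral_eq_zero_of_forall_smoothTrace_eq_zero` (+ the organ spelling `orbInt_eq_zero_of_forall_smoothTrace_eq_zero` under the rung-0 pin `𝔇.orb = mQv`);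
R47-d («`tr i_G(χ)(f_EP^{V,e}) = 0` for all `χ`», F0P3a-p04) discharges `hsp` at `φ = f_EP^{V,e}`, giving the `regG ∖ ellG` clause of ★ `EllipticData.IsPseudoCoeff`.
HONEST LABEL: HC_CM is proved only modulo the 7 printed citations (2 remaining: hLiu418 = stmt-HodgeConjecture-24832, h413 = stmt-HodgeConjecture-24833) until rung 0 closes;
count-neutral, hypothesis-fed (`hsp`).

## References
* [Rogawski1990] J. D. Rogawski, *Automorphic Representations of Unitary Groups in Three Variables* (1990): §4.9 (4.9.4) p. 56; §12.6 p. 187; §12.7 L. 12.7.2 p. 193.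
* [vanDijk1972] G. van Dijk, *Computation of certain induced characters of 𝔭-adic groups*, Math. Ann. 199 (1972), Thm. p. 237.
* [SchneiderStuhler1997] P. Schneider, U. Stuhler, *Representation theory and sheaves on the Bruhat–Tits building*, Publ. IHÉS 85 (1997): III.4.
* [HewittRoss1979] E. Hewitt, K. A. Ross, *Abstract Harmonic Analysis I*: Thm. (23.11).
-/

set_option autoImplicit false
-- the mandated namespace has the single-problem summit's repeated segment (`HodgeConjecture.HodgeConjecture`)
set_option linter.dupNamespace false

noncomputable section

open NumberField IsDedekindDomain MeasureTheory MeasureTheory.Measure Filter Topology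
open scoped Matrix MatrixGroups NNReal Pointwise
open Literature.NumberTheory.Rogawski1990 Literature.NumberTheory.Rogawski1990.Ch12Sec5
open Literature.NumberTheory.Automorphic Literature.NumberTheory.Automorphic.UnitaryGroup
open Literature.MeasureTheory.Group
open Summit.HodgeConjecture.HodgeConjecture.Cruxes.H413.F0P3cStCharTSTorusDefs

namespace Summit.HodgeConjecture.HodgeConjecture.Cruxes.H413.F0P3cStCharTSEPNonEllipticVanishing

/-! ## §1 Generic: closed subgroups of a locally compact non-archimedean group have small compact open subgroups -/

/-- In a locally compact Hausdorff non-archimedean group `G`, every neighbourhood of `1` in a CLOSED subgroup `M` contains a compact open subgroup of `M`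
(an open subgroup of `G` inside a compact neighbourhood is compact; intersect with `M`). [cite: HewittRoss1979, Thm. (7.7)] -/
theorem exists_isOpen_isCompact_subgroup_subset {G : Type*} [Group G] [TopologicalSpace G] [NonarchimedeanGroup G]
    [LocallyCompactSpace G] [T2Space G] (M : Subgroup G) (hM : IsClosed (M : Set G)) (U : Set ↥M) (hU : U ∈ 𝓝 (1 : ↥M)) :
    ∃ C : Subgroup ↥M, IsOpen (C : Set ↥M) ∧ IsCompact (C : Set ↥M) ∧ (C : Set ↥M) ⊆ U := by
  -- `U ⊇ M ∩ W` for a neighbourhood `W` of `1` in `G`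
  rw [nhds_subtype_eq_comap, Filter.mem_comap] at hU
  obtain ⟨W, hW, hWU⟩ := hU
  obtain ⟨K, hK, hK1⟩ := exists_compact_mem_nhds (1 : G)
  obtain ⟨V, hV⟩ := NonarchimedeanGroup.is_nonarchimedean (W ∩ interior K) (Filter.inter_mem hW (interior_mem_nhds.2 hK1))
  have hVK : IsCompact (V : Set G) :=
    hK.of_isClosed_subset V.isClosed ((hV.trans Set.inter_subset_right).trans interior_subset)
  refine ⟨(V : Subgroup G).subgroupOf M, ?_, ?_, ?_⟩
  · exact V.isOpen.preimage continuous_subtype_val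
  · exact hM.isClosedEmbedding_subtypeVal.isCompact_preimage hVK
  · intro x hx
    exact hWU (Set.mem_preimage.2 ((hV (Subgroup.mem_subgroupOf.1 hx)).1))

/-! ## §2 The datum `U(Φ₃)(L⁺_v)`: vanishing of all principal-series traces ⇒ vanishing of the canonical orbital integrals off the elliptic set -/

section Datum

variable (L : Type) [Field L] [NumberField L] [IsCMField L] (v : HeightOneSpectrum (𝓞 ↥(maximalRealSubfield L)))

set_option maxHeartbeats 3200000 in
set_option synthInstance.maxHeartbeats 400000 in
/-- **R47-e HEAD (route A (A4)–(A6) at the datum).**  Let `v` be a finite place of `L⁺` that does not split in `L` (`hns`), `ν` a Haar measure on `G = U(Φ₃)(L⁺_v)`,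
`mQv` the CANONICAL orbital measures (★ `IsCanonical` for the regular elements), `φ` locally constant with compact support.  If `tr i_G(χ)(φ) = 0` for EVERY
continuous character `χ` of the diagonal torus `T` (`hsp`), then `Φ^{can}(γ, φ) = 0` for every regular `γ` whose centraliser is NOT compact.
Proof: such a `γ` is conjugate to a regular `t ∈ T` (★ `isCompact_centralizer_iff_not_mem_hyperbolicSet`); ★ S0 writes `Φ^{can}(t, φ) = c • Ψ_φ(t)` with the constant term
`Ψ_φ(t) = ∫_{K×N} φ(k (t n) k⁻¹)`; ★ S1 (van Dijk, torus form) and `hsp` give `∫_T χ δ^{1∕2} Ψ_φ dμ_T = 0` for all continuous `χ`, and `δ^{1∕2} Ψ_φ` is continuous with compact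
support on `T` (★ E2), so it vanishes identically by ★ E1 (`T` has small compact open subgroups, §1); `δ^{1∕2} ≠ 0`.
(The `maxHeartbeats 3200000` ∕ `synthInstance.maxHeartbeats 400000` on this declaration are the `whnf` wall of instantiating ★ S1 (van Dijk, torus form) and ★ S0 on the
`U(Φ₃)(L⁺_v)` carrier, exactly as in ★ (4.9.4) `smoothTrace_cmPrincipalSeries_map_symm_eq_inv_mul_integral`; the proof itself is short.)
[cite: Rogawski1990, §12.6 p. 187; §12.7 L. 12.7.2 (proof) p. 193; §4.9 (4.9.4) p. 56] [cite: vanDijk1972, Thm. p. 237] [cite: SchneiderStuhler1997, III.4] -/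
theorem classOrbitalIntegral_eq_zero_of_forall_smoothTrace_eq_zero
    (hns : ∀ w : PlacesOver L v, IsCMField.complexConj L • w.1 = w.1)
    [MeasurableSpace (Gqs L v)] [BorelSpace (Gqs L v)]
    [∀ γ : Gqs L v, MeasurableSpace (Gqs L v ⧸ Subgroup.centralizer ({γ} : Set (Gqs L v)))]
    [∀ γ : Gqs L v, BorelSpace (Gqs L v ⧸ Subgroup.centralizer ({γ} : Set (Gqs L v)))]
    (νQv : Measure (Gqs L v)) [νQv.IsHaarMeasure] [νQv.IsMulRightInvariant]
    (mQv : OrbitalMeasureFamily (Gqs L v))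
    (hcanQ : mQv.IsCanonical (fun γ => IsRegularElt (γ.val : GL (Fin 3) (UnitaryGroup.LocalRing L v))) νQv)
    (φ : Gqs L v → ℂ) (hφ : IsLocallyConstant φ) (hφc : HasCompactSupport φ)
    (hsp : ∀ χ : ↥(cmBorelTriple L 3 v).M →* ℂˣ, Continuous (fun t => ((χ t : ℂˣ) : ℂ)) →
      Representation.smoothTrace (G := Gqs L v) (UnitaryGroup.cmPrincipalSeries L 3 v χ) νQv φ = 0)
    {γ : Gqs L v} (hreg : IsRegularElt (γ.val : GL (Fin 3) (UnitaryGroup.LocalRing L v)))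
    (hnc : ¬ IsCompact ((Subgroup.centralizer ({γ} : Set (Gqs L v))) : Set (Gqs L v))) :
    classOrbitalIntegral mQv φ (ConjClasses.mk γ) = 0 := by
  obtain ⟨w⟩ := (inferInstance : Nonempty (PlacesOver L v))
  have hw : IsCMField.complexConj L • w.1 = w.1 := hns w
  -- the organ's structures, read on the (definitionally equal) matrix carrier `U(Φ₃)(L⁺_v)`
  letI hmsU : MeasurableSpace ↥(unitaryGroupOfForm (conjLocal L (IsCMField.complexConj L) v) (cmLocalForm L 3 v)) := ‹MeasurableSpace (Gqs L v)›
  haveI : BorelSpace ↥(unitaryGroupOfForm (conjLocal L (IsCMField.complexConj L) v) (cmLocalForm L 3 v)) := ⟨BorelSpace.measurable_eq (α := Gqs L v)⟩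
  haveI hνU : Measure.IsHaarMeasure (G := ↥(unitaryGroupOfForm (conjLocal L (IsCMField.complexConj L) v) (cmLocalForm L 3 v))) νQv := by exact ‹νQv.IsHaarMeasure›
  haveI := locallyCompactSpace_cmBorelU L 3 v
  haveI : LocallyCompactSpace ↥(unitaryGroupOfForm (conjLocal L (IsCMField.complexConj L) v) (cmLocalForm L 3 v)) := locallyCompactSpace_local (IsCMField.complexConj L) 3 _ v
  haveI : SecondCountableTopology ↥(unitaryGroupOfForm (conjLocal L (IsCMField.complexConj L) v) (cmLocalForm L 3 v)) := secondCountableTopology_local (IsCMField.complexConj L) 3 _ v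
  haveI : T2Space ↥(unitaryGroupOfForm (conjLocal L (IsCMField.complexConj L) v) (cmLocalForm L 3 v)) := t2Space_cmDatum_local 3 L (Matrix.of fun i j : Fin 3 => if i.val + j.val + 1 = 3 then (1 : L) else 0) v
  -- `B = T N`: closed pieces, continuous Levi projection; `T` abelian, locally compact, second countable, σ-compact
  have hMcl := isClosed_cmBorelTriple_M L v
  have hNcl := isClosed_cmBorelTriple_N L v
  have hBcl : IsClosed ((cmBorelTriple L 3 v).P : Set ↥(unitaryGroupOfForm (conjLocal L (IsCMField.complexConj L) v) (cmLocalForm L 3 v))) :=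
    isClosed_borelU (conjLocal L (IsCMField.complexConj L) v) (cmLocalForm L 3 v)
  have hproj : Continuous (cmBorelTriple L 3 v).proj :=
    continuous_proj_borelTriple (conjLocal L (IsCMField.complexConj L) v) (cmLocalForm L 3 v) (cmLocalForm_eq_over L 3 v)
  haveI : LocallyCompactSpace ↥(cmBorelTriple L 3 v).M := hMcl.isClosedEmbedding_subtypeVal.locallyCompactSpace
  haveI : SecondCountableTopology ↥(cmBorelTriple L 3 v).M := TopologicalSpace.Subtype.secondCountableTopology _
  haveI : SigmaCompactSpace ↥(cmBorelTriple L 3 v).M := sigmaCompactSpace_of_locallyCompact_secondCountable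
  haveI : LocallyCompactSpace ↥(cmBorelTriple L 3 v).N := hNcl.isClosedEmbedding_subtypeVal.locallyCompactSpace
  haveI : SecondCountableTopology ↥(cmBorelTriple L 3 v).N := TopologicalSpace.Subtype.secondCountableTopology _
  haveI : SigmaCompactSpace ↥(cmBorelTriple L 3 v).N := sigmaCompactSpace_of_locallyCompact_secondCountable
  -- the hyperspecial level `K = K_v`: compact open, Iwasawa `G = B · K`
  set K : Subgroup ↥(unitaryGroupOfForm (conjLocal L (IsCMField.complexConj L) v) (cmLocalForm L 3 v)) := cmLocalIntegralLevel L 3 (Matrix.of fun i j : Fin 3 => if i.val + j.val + 1 = 3 then (1 : L) else 0) v with hK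
  have hKv : ∀ g : ↥(unitaryGroupOfForm (conjLocal L (IsCMField.complexConj L) v) (cmLocalForm L 3 v)), g ∈ K ↔ g ∈ cmLocalIntegralLevel L 3 (Matrix.of fun i j : Fin 3 => if i.val + j.val + 1 = 3 then (1 : L) else 0) v := fun g => Iff.rfl
  have hKco := isCompact_isOpen_cmLocalIntegralLevel L 3 (Matrix.of fun i j : Fin 3 => if i.val + j.val + 1 = 3 then (1 : L) else 0) v
  have hKo : IsOpen (K : Set ↥(unitaryGroupOfForm (conjLocal L (IsCMField.complexConj L) v) (cmLocalForm L 3 v))) := hKco.2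
  have hKc : IsCompact (K : Set ↥(unitaryGroupOfForm (conjLocal L (IsCMField.complexConj L) v) (cmLocalForm L 3 v))) := hKco.1
  have hGK : ∀ g : ↥(unitaryGroupOfForm (conjLocal L (IsCMField.complexConj L) v) (cmLocalForm L 3 v)), ∃ b : ↥(cmBorelTriple L 3 v).P, ∃ k ∈ K, g = b * k := by
    intro g
    obtain ⟨b, k, hk, hg⟩ := exists_borel_mul_mem_cmLocalIntegralLevel L 3 v g
    exact ⟨b, k, (hKv k).2 hk, hg⟩
  haveI : CompactSpace ↥K := isCompact_iff_compactSpace.1 hKc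
  -- Haar measures on `K`, `N`, `T`
  let κ : Measure ↥K := Measure.haar
  let μN : Measure ↥(cmBorelTriple L 3 v).N := Measure.haar
  let μT : Measure ↥(cmBorelTriple L 3 v).M := Measure.haar
  haveI : SigmaFinite μN := inferInstance
  -- the constant term `Ψ_φ` (on `G`) and van Dijk's weight-free torus integrand `δ^{1∕2} Ψ_φ` (on `T`)
  have hφcont : Continuous φ := hφ.continuous
  set I : ↥(unitaryGroupOfForm (conjLocal L (IsCMField.complexConj L) v) (cmLocalForm L 3 v)) → ℂ := fun g =>
    ∫ p : ↥K × ↥(cmBorelTriple L 3 v).N, φ ((p.1 : ↥(unitaryGroupOfForm (conjLocal L (IsCMField.complexConj L) v) (cmLocalForm L 3 v))) * (g * (p.2 : ↥(unitaryGroupOfForm (conjLocal L (IsCMField.complexConj L) v) (cmLocalForm L 3 v)))) * (p.1 : ↥(unitaryGroupOfForm (conjLocal L (IsCMField.complexConj L) v) (cmLocalForm L 3 v)))⁻¹) ∂(κ.prod μN) with hIdef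
  set Ψ : ↥(cmBorelTriple L 3 v).M → ℂ := fun t =>
    ((rootDeltaChar (cmBorelTriple L 3 v).P ⟨(t : ↥(unitaryGroupOfForm (conjLocal L (IsCMField.complexConj L) v) (cmLocalForm L 3 v))), (cmBorelTriple L 3 v).M_le t.2⟩ : ℂˣ) : ℂ) * I (t : ↥(unitaryGroupOfForm (conjLocal L (IsCMField.complexConj L) v) (cmLocalForm L 3 v))) with hΨdef
  -- (A5) `Ψ` is continuous with compact support (★ E2) …
  have hIc : Continuous I :=
    continuous_integral_conj_torus_mul_prod K hKc κ (cmBorelTriple L 3 v).N hNcl μN hφcont hφc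
  have hIK : HasCompactSupport fun t : ↥(cmBorelTriple L 3 v).M => I (t : ↥(unitaryGroupOfForm (conjLocal L (IsCMField.complexConj L) v) (cmLocalForm L 3 v))) :=
    hasCompactSupport_integral_conj_torus_mul_prod K hKc κ (cmBorelTriple L 3 v) hBcl hproj μN hφc
  have hδc : Continuous fun t : ↥(cmBorelTriple L 3 v).M =>
      ((rootDeltaChar (cmBorelTriple L 3 v).P ⟨(t : ↥(unitaryGroupOfForm (conjLocal L (IsCMField.complexConj L) v) (cmLocalForm L 3 v))), (cmBorelTriple L 3 v).M_le t.2⟩ : ℂˣ) : ℂ) :=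
    (continuous_rootDeltaChar_unitsCoe' (cmBorelTriple L 3 v).P).comp (Continuous.subtype_mk continuous_subtype_val _)
  have hΨc : Continuous Ψ := hδc.mul (hIc.comp continuous_subtype_val)
  have hΨK : HasCompactSupport Ψ := hIK.mul_left
  -- … and is killed by every continuous (locally constant, unitary) character of `T` (★ S1 + `hsp`)
  have hΨχ : ∀ χ : ↥(cmBorelTriple L 3 v).M →* ℂˣ, Continuous χ → IsLocallyConstant χ →
      (∀ t, ‖((χ t : ℂˣ) : ℂ)‖ = 1) → ∫ t, ((χ t : ℂˣ) : ℂ) * Ψ t ∂μT = 0 := by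
    intro χ hχ _ _
    have hχ' : Continuous fun t => ((χ t : ℂˣ) : ℂ) := Units.continuous_val.comp hχ
    obtain ⟨C, hC, -, hprod, -⟩ :=
      exists_smoothTrace_cmPrincipalSeries_eq_integral_torus L 3 v χ hχ' K hKo hKc hGK νQv μT μN κ
    have h0 : (C : ℂ) * ∫ t : ↥(cmBorelTriple L 3 v).M,
        (((χ t : ℂˣ) : ℂ) * ((rootDeltaChar (cmBorelTriple L 3 v).P ⟨(t : ↥(unitaryGroupOfForm (conjLocal L (IsCMField.complexConj L) v) (cmLocalForm L 3 v))), (cmBorelTriple L 3 v).M_le t.2⟩ : ℂˣ) : ℂ)) * I (t : ↥(unitaryGroupOfForm (conjLocal L (IsCMField.complexConj L) v) (cmLocalForm L 3 v))) ∂μT = 0 :=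
      (hprod φ hφ hφc).symm.trans (hsp χ hχ')
    have hC' : (C : ℂ) ≠ 0 := by exact_mod_cast hC.ne'
    have h1 := (mul_eq_zero.1 h0).resolve_left hC'
    simpa only [hΨdef, mul_assoc] using h1
  -- (A5) concluded: `Ψ ≡ 0` on `T` (★ E1 with the small compact open subgroups of §1), hence `Ψ_φ ≡ 0` on `T`
  have hbasis : ∀ U ∈ 𝓝 (1 : ↥(cmBorelTriple L 3 v).M), ∃ C : Subgroup ↥(cmBorelTriple L 3 v).M,
      IsOpen (C : Set ↥(cmBorelTriple L 3 v).M) ∧ IsCompact (C : Set ↥(cmBorelTriple L 3 v).M) ∧ (C : Set ↥(cmBorelTriple L 3 v).M) ⊆ U :=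
    fun U hU => @exists_isOpen_isCompact_subgroup_subset ↥(unitaryGroupOfForm (conjLocal L (IsCMField.complexConj L) v) (cmLocalForm L 3 v)) _ _
      (nonarchimedeanGroup_unitaryGroupOfForm_local (E := L) (c := IsCMField.complexConj L) (N := 3) (v := v) (J' := cmLocalForm L 3 v))
      _ _ (cmBorelTriple L 3 v).M hMcl U hU
  -- `T` is abelian: bundle the commutativity for ★ E1
  have hcomm : ∀ a b : ↥(cmBorelTriple L 3 v).M, a * b = b * a := fun a b => by
    obtain ⟨d₁, hd₁⟩ := (mem_torusU_iff (a : ↥(unitaryGroupOfForm (conjLocal L (IsCMField.complexConj L) v) (cmLocalForm L 3 v)))).1 a.2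
    obtain ⟨d₂, hd₂⟩ := (mem_torusU_iff (b : ↥(unitaryGroupOfForm (conjLocal L (IsCMField.complexConj L) v) (cmLocalForm L 3 v)))).1 b.2
    apply Subtype.ext
    apply Subtype.ext
    rw [Subgroup.coe_mul, Subgroup.coe_mul, Subgroup.coe_mul, Subgroup.coe_mul, ← hd₁, ← hd₂, ← map_mul, ← map_mul, mul_comm]
  letI : CommGroup ↥(cmBorelTriple L 3 v).M := { (inferInstance : Group ↥(cmBorelTriple L 3 v).M) with mul_comm := hcomm }
  have hΨ0 : Ψ = 0 := eq_zero_of_continuous_of_forall_integral_char_mul_eq_zero μT hbasis Ψ hΨc hΨK hΨχ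
  have hI0 : ∀ t : ↥(cmBorelTriple L 3 v).M, I (t : ↥(unitaryGroupOfForm (conjLocal L (IsCMField.complexConj L) v) (cmLocalForm L 3 v))) = 0 := fun t => by
    have h := congr_fun hΨ0 t
    simp only [hΨdef, Pi.zero_apply, mul_eq_zero, Units.ne_zero, false_or] at h
    exact h
  -- (A6) `γ` is conjugate to a regular `t ∈ T`, where `Φ^{can}(t, φ) = c • Ψ_φ(t) = 0` (★ S0 at the identity frame)
  have hΩ : γ ∈ hyperbolicSet L v := by
    by_contra hΩ
    exact hnc ((F0P3cStCharTSEllCartanCompact.isCompact_centralizer_iff_not_mem_hyperbolicSet L v hns hreg).2 hΩ)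
  obtain ⟨t, htreg, htconj⟩ := hΩ
  refine (congrArg (classOrbitalIntegral mQv φ) (ConjClasses.mk_eq_mk_iff_isConj.2 htconj).symm).trans ?_
  obtain ⟨d, hd⟩ := (mem_torusU_iff (t : ↥(unitaryGroupOfForm (conjLocal L (IsCMField.complexConj L) v) (cmLocalForm L 3 v)))).1 t.2
  have hdreg : ∀ i j : Fin 3, i ≠ j → IsUnit ((d i : UnitaryGroup.LocalRing L v) - d j) := fun i j hij =>
    F0P3cStCharTSWeylHypFibre.isUnit_sub_of_isRegularElt_glDiagonal (by rw [hd]; exact htreg) hij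
  have hunit : ∀ i : Fin 3, i ≠ 0 → IsUnit ((((d 0)⁻¹ * d i : (UnitaryGroup.LocalRing L v)ˣ) : UnitaryGroup.LocalRing L v) - 1) := by
    intro i hi
    have h0 : (((d 0)⁻¹ * d i : (UnitaryGroup.LocalRing L v)ˣ) : UnitaryGroup.LocalRing L v) - 1 =
        (((d 0)⁻¹ : (UnitaryGroup.LocalRing L v)ˣ) : UnitaryGroup.LocalRing L v) * ((d i : UnitaryGroup.LocalRing L v) - d 0) := by
      rw [Units.val_mul, mul_sub, Units.inv_mul]
    rw [h0]
    exact (Units.isUnit _).mul (hdreg i 0 hi)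
  have h1 : formCongr (conjLocal L (IsCMField.complexConj L) v) (1 : GL (Fin 3) (UnitaryGroup.LocalRing L v)) ((qsForm L).map (algebraMap L (UnitaryGroup.LocalRing L v))) =
      (1 : UnitaryGroup.LocalRing L v) • (Matrix.of fun i j : Fin 3 => if i.val + j.val + 1 = 3 then (1 : L) else 0).map (algebraMap L (UnitaryGroup.LocalRing L v)) := by
    rw [formCongr_one_eq, one_smul]
  have he : ∀ g, (cmDatumLocalCongr L v (1 : GL (Fin 3) (UnitaryGroup.LocalRing L v)) isUnit_one h1) g = g := fun g => by
    apply Subtype.ext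
    rw [coe_cmDatumLocalCongr_apply, inv_one, mul_one, one_mul]
  have key := classOrbitalIntegral_eq_smul_integral_prod_of_torus_regular L (qsForm L) (antidiagOne_isHermitian L 3) (isUnit_antidiagOne_det L 3) w hw
    (1 : GL (Fin 3) (UnitaryGroup.LocalRing L v)) isUnit_one h1 νQv hcanQ hKv κ μN t hd hdreg
    (hunit 1 (by decide)) (hunit 2 (by decide)) hφcont.measurable
  have hint : ∫ p : ↥K × ↥(cmBorelTriple L 3 v).N,
      φ (cmDatumLocalCongr L v (1 : GL (Fin 3) (UnitaryGroup.LocalRing L v)) isUnit_one h1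
        ((p.1 : ↥(unitaryGroupOfForm (conjLocal L (IsCMField.complexConj L) v) (cmLocalForm L 3 v))) * ((t : ↥(unitaryGroupOfForm (conjLocal L (IsCMField.complexConj L) v) (cmLocalForm L 3 v))) * (p.2 : ↥(unitaryGroupOfForm (conjLocal L (IsCMField.complexConj L) v) (cmLocalForm L 3 v)))) * (p.1 : ↥(unitaryGroupOfForm (conjLocal L (IsCMField.complexConj L) v) (cmLocalForm L 3 v)))⁻¹)) ∂(κ.prod μN) = I (t : ↥(unitaryGroupOfForm (conjLocal L (IsCMField.complexConj L) v) (cmLocalForm L 3 v))) := by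
    simp only [hIdef]
    refine integral_congr_ae (Eventually.of_forall fun p => ?_)
    dsimp only
    rw [he]
  rw [hint, hI0 t, smul_zero, he] at key
  exact key

/-- **R47-e HEAD in the organ's spelling** (`𝔇.orbInt γ φ = Φ(γ, φ)`, ★ `EllipticData.orbInt`): for the rung-0 datum `𝔇` on `U(Φ₃)(L⁺_v)` whose orbital measures are the
canonical ones for `𝔇.μG` (`hcan`), vanishing of all principal-series traces of `φ` (`hsp`) forces `𝔇.orbInt γ φ = 0` at every regular `γ` with non-compact centraliser —
the `regG ∖ ellG` clause of ★ `EllipticData.IsPseudoCoeff` once `regG ⊆` regular and `ellG ⊇` compact-centraliser regular (print p. 184, ★ `F0P3cStCharTSEllCartanCompact`).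
[cite: Rogawski1990, §12.6 p. 187; §12.5 p. 182] -/
theorem orbInt_eq_zero_of_forall_smoothTrace_eq_zero
    (hns : ∀ w : PlacesOver L v, IsCMField.complexConj L • w.1 = w.1)
    [MeasurableSpace (Gqs L v)] [BorelSpace (Gqs L v)]
    [∀ γ : Gqs L v, MeasurableSpace (Gqs L v ⧸ Subgroup.centralizer ({γ} : Set (Gqs L v)))]
    [∀ γ : Gqs L v, BorelSpace (Gqs L v ⧸ Subgroup.centralizer ({γ} : Set (Gqs L v)))]
    [MeasurableSpace (Gqs L v ⧸ Subgroup.center (Gqs L v))]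
    {H : Type} [Group H] [TopologicalSpace H] [IsTopologicalGroup H] [MeasurableSpace H]
    (𝔇 : EllipticData (Gqs L v) H) [𝔇.μG.IsHaarMeasure] [𝔇.μG.IsMulRightInvariant]
    (hcan : 𝔇.orb.IsCanonical (fun γ => IsRegularElt (γ.val : GL (Fin 3) (UnitaryGroup.LocalRing L v))) 𝔇.μG)
    (φ : Gqs L v → ℂ) (hφ : IsLocallyConstant φ) (hφc : HasCompactSupport φ)
    (hsp : ∀ χ : ↥(cmBorelTriple L 3 v).M →* ℂˣ, Continuous (fun t => ((χ t : ℂˣ) : ℂ)) →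
      Representation.smoothTrace (G := Gqs L v) (UnitaryGroup.cmPrincipalSeries L 3 v χ) 𝔇.μG φ = 0)
    {γ : Gqs L v} (hreg : IsRegularElt (γ.val : GL (Fin 3) (UnitaryGroup.LocalRing L v)))
    (hnc : ¬ IsCompact ((Subgroup.centralizer ({γ} : Set (Gqs L v))) : Set (Gqs L v))) :
    𝔇.orbInt γ φ = 0 :=
  classOrbitalIntegral_eq_zero_of_forall_smoothTrace_eq_zero L v hns 𝔇.μG 𝔇.orb hcan φ hφ hφc hsp hreg hnc

end Datum

end Summit.HodgeConjecture.HodgeConjecture.Cruxes.H413.F0P3cStCharTSEPNonEllipticVanishing
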